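import Summits.Ventures.PercRepro.RankLevelSetLevelSevenRowsFiftyFourToFiftyFive
import Summits.Ventures.PercRepro.RankLevelSetLevelSevenRowFiftyThree
import Summits.Ventures.PercRepro.RankLevelSetLevelSevenRowFiftyTwo
import Summits.Ventures.PercRepro.RankLevelSetLevelSevenRowFiftyOne
import Summits.Ventures.PercRepro.RankLevelSetLevelSevenRowFifty
import Summits.Ventures.PercRepro.RankLevelSetLevelSevenRowFortyNine
import Summits.Ventures.PercRepro.RankLevelSetLevelSevenRowFortyEight

/-!
# PercRepro — THE ROWS `53 … 48` OF LEVEL `7`: C-025 AT `q = 7` FOR EVERY FINITE MATROID AND EVERY `p ≥ 48`, ON THE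
TELESCOPING COUNT WITH THE BOOTSTRAPPED TRIANGLE COUNT, T4⁺ AND THE NULLITY SPLIT (p8, gen 21; a feeder for S4 — the top of the `q = 7` window moves from `54` to `48`)

Each row from the row above and its own rank: `c025_seven_large_<word> (P ≤ p) : RLS M p 7` is `c025_seven_at_<word>`
(RankLevelSetLevelSevenRow<Word>) at `p = P` and the row `P + 1` above it; the row `54` is `c025_seven_large_fifty_four`
(RankLevelSetLevelSevenRowsFiftyFourToFiftyFive). The chain `53 → … → 48`; the literal `C025` body at `48`
(`c025_seven_forty_eight`). Axioms: standard.
-/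

open scoped Matroid

namespace PercRepro

namespace ThmN

variable {α : Type}

/-- **THEOREM C₇ AT `53`, UNCONDITIONAL OVER THE TREE**: every finite matroid satisfies C-025 at level `7` for every
`p ≥ 53` — the row `53` by `c025_seven_at_fifty_three`, the rows `≥ 54` by `c025_seven_large_fifty_four`. -/
theorem c025_seven_large_fifty_three (M : Matroid α) [M.Finite] (p : ℕ) (hp : 53 ≤ p) : RLS M p 7 := by
  rcases Nat.lt_or_ge p 54 with h | h
  · have h53 : p = 53 := by omega
    subst h53
    exact c025_seven_at_fifty_three M
  · exact c025_seven_large_fifty_four M p h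

/-- **THEOREM C₇ AT `52`, UNCONDITIONAL OVER THE TREE**: every finite matroid satisfies C-025 at level `7` for every
`p ≥ 52` — the row `52` by `c025_seven_at_fifty_two`, the rows `≥ 53` by `c025_seven_large_fifty_three`. -/
theorem c025_seven_large_fifty_two (M : Matroid α) [M.Finite] (p : ℕ) (hp : 52 ≤ p) : RLS M p 7 := by
  rcases Nat.lt_or_ge p 53 with h | h
  · have h52 : p = 52 := by omega
    subst h52
    exact c025_seven_at_fifty_two M
  · exact c025_seven_large_fifty_three M p h

/-- **THEOREM C₇ AT `51`, UNCONDITIONAL OVER THE TREE**: every finite matroid satisfies C-025 at level `7` for every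
`p ≥ 51` — the row `51` by `c025_seven_at_fifty_one`, the rows `≥ 52` by `c025_seven_large_fifty_two`. -/
theorem c025_seven_large_fifty_one (M : Matroid α) [M.Finite] (p : ℕ) (hp : 51 ≤ p) : RLS M p 7 := by
  rcases Nat.lt_or_ge p 52 with h | h
  · have h51 : p = 51 := by omega
    subst h51
    exact c025_seven_at_fifty_one M
  · exact c025_seven_large_fifty_two M p h

/-- **THEOREM C₇ AT `50`, UNCONDITIONAL OVER THE TREE**: every finite matroid satisfies C-025 at level `7` for every
`p ≥ 50` — the row `50` by `c025_seven_at_fifty`, the rows `≥ 51` by `c025_seven_large_fifty_one`. -/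
theorem c025_seven_large_fifty (M : Matroid α) [M.Finite] (p : ℕ) (hp : 50 ≤ p) : RLS M p 7 := by
  rcases Nat.lt_or_ge p 51 with h | h
  · have h50 : p = 50 := by omega
    subst h50
    exact c025_seven_at_fifty M
  · exact c025_seven_large_fifty_one M p h

/-- **THEOREM C₇ AT `49`, UNCONDITIONAL OVER THE TREE**: every finite matroid satisfies C-025 at level `7` for every
`p ≥ 49` — the row `49` by `c025_seven_at_forty_nine`, the rows `≥ 50` by `c025_seven_large_fifty`. -/
theorem c025_seven_large_forty_nine (M : Matroid α) [M.Finite] (p : ℕ) (hp : 49 ≤ p) : RLS M p 7 := by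
  rcases Nat.lt_or_ge p 50 with h | h
  · have h49 : p = 49 := by omega
    subst h49
    exact c025_seven_at_forty_nine M
  · exact c025_seven_large_fifty M p h

/-- **THEOREM C₇ AT `48`, UNCONDITIONAL OVER THE TREE**: every finite matroid satisfies C-025 at level `7` for every
`p ≥ 48` — the row `48` by `c025_seven_at_forty_eight`, the rows `≥ 49` by `c025_seven_large_forty_nine`. -/
theorem c025_seven_large_forty_eight (M : Matroid α) [M.Finite] (p : ℕ) (hp : 48 ≤ p) : RLS M p 7 := by
  rcases Nat.lt_or_ge p 49 with h | h
  · have h48 : p = 48 := by omega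
    subst h48
    exact c025_seven_at_forty_eight M
  · exact c025_seven_large_forty_nine M p h

/-- The same in the literal `C025` body: `phiK p 7 · #U(p, 7) ≤ #Y(p, 7)` for every finite matroid and every `p ≥ 48`. -/
theorem c025_seven_forty_eight (M : Matroid α) [M.Finite] (p : ℕ) (hp : 48 ≤ p) :
    phiK p 7 * ({A : Set α | A ⊆ M.E ∧ M.eRk A = (p : ℕ∞) ∧ M.eRk (M.E \ A) = (7 : ℕ∞)}.ncard : ℚ) ≤
      ({A : Set α | A ⊆ M.E ∧ (7 : ℕ∞) < M.eRk A ∧ M.eRk A < (p : ℕ∞)}.ncard : ℚ) :=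
  c025_seven_large_forty_eight M p hp

end ThmN

end PercRepro
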